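import Summits.HodgeConjecture.HodgeConjecture.Theorems.Q8SymplecticPowersRegularOfDesingularization
import Literature.AlgebraicGeometry.HodgeTheory.BettiHodgeNumbersOfHodgeModels
import HarnessLib

/-!
# Route `Q8SymplecticPowers`, crux K1Q (stmt-HodgeConjecture-24190), line `mechanism-v2`: stub S1 `stub_regularVeryGeneralQ`
# FROM THE IRREGULARITY — «`q(S) = 0` for every desingularisation `S` of the general quaternionic quartic plane»

Helper file (`--supports stmt-HodgeConjecture-24190 --as helper`; nothing here closes an item). Sorry-free; axioms standard; no
definition; no named fact.

`Q8SymplecticPowersRegularOfDesingularization.stub_regularVeryGeneralQ_of_desingularizations_regular` (this seat, p794327) reduces S1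
to (D) «`b₁(X₀) = 0` for every smooth projective `X₀` birational to the good fibre `𝒱_a = fiberSch e (eval a)`, `a` general». The
printed theorems on cyclic multiple planes (Zariski 1931; Esnault–Viehweg 1982; D. Naie, Enseign. Math. 53 (2007), Thm. 3.1) compute the
IRREGULARITY `q(S) = h^{0,1}(S) = h¹(S, 𝒪_S)`, not `b₁`; the two renderings are bridged by the Hodge decomposition of `H¹` and Hodge
symmetry, both tree theorems for the Betti universe's Hodge structure `BettiUniverse.hodge` (`finrank_bettiCohomology_eq_sum_hodgeNumber_hodge`,
`hodgeNumber_hodge_symm`):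

* `finrank_bettiCohomology_one_eq_two_mul_irregularity` — `b₁(X) = 2 · h^{0,1}(H¹(X))` for every smooth projective complex `X`;
* `finrank_bettiCohomology_one_eq_zero_iff_irregularity_eq_zero` — `b₁(X) = 0 ↔ h^{0,1}(H¹(X)) = 0`;
* `stub_regularVeryGeneralQ_of_desingularizations_irregularity_zero` — S1 VERBATIM from

> **(Q)** for every even `e ≥ 4` there is `0 ≠ g ∈ ℂ[a]` such that for every `a` with `g(a) ≠ 0`, `G_e(a) ≠ 0`, every smooth projective
> surface `X₀` birational over `ℂ` to `𝒱_a` has `h^{0,1}(H¹(X₀)) = dim_ℂ (hodge _ hX₀ 1).piece 0 1 = 0`,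

which is Naie's Thm. 3.1 «`q(S) = Σ_{ξ ∈ J(B,n)} h¹(ℙ², I_{Z(ξB)}(−3 + ξb))`» for `n = 4`, `B = c + 3σc + 2(x₀−x₁) + 2ψ`, `b = 2e + 4`, `H_∞ = {x₂ = 0}`,
where every `𝒥(ξB)` is invertible for general `(c, ψ)` and each summand is an `h¹(ℙ², 𝒪(k)) = 0` (seat memo `S1-RESIDUE-leafhand-g0.md`
on the item). Honest scope: a reduction; S1, K1Q, HC are NOT proved here.
-/

set_option linter.dupNamespace false

noncomputable section

open CategoryTheory AlgebraicGeometry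
open Literature.AlgebraicGeometry Literature.AlgebraicGeometry.Motives Literature.AlgebraicGeometry.HodgeTheory
open Literature.AlgebraicGeometry.HodgeTheory.BettiUniverse Literature.AlgebraicGeometry.HodgeTheory.Q8Family

namespace Summit.HodgeConjecture.HodgeConjecture.Theorems.Q8SymplecticPowersRegularOfIrregularityZero

/-- **`b₁(X) = 2·q(X)`**: for a smooth projective complex variety, `dim_ℚ H¹(X(ℂ); ℚ) = h^{1,0} + h^{0,1} = 2·h^{0,1}` (Hodge
decomposition of `H¹` and Hodge symmetry, for the tree's Hodge structure `BettiUniverse.hodge _ hX 1`).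
[cite: VoisinHodgeI2002, §6.1.3 Cor. 6.12 and Cor. 6.13] -/
theorem finrank_bettiCohomology_one_eq_two_mul_irregularity {n : ℕ} {X : SchemeOver ℂ} (hX : IsSmoothProjective n X) :
    Module.finrank ℚ (bettiCohomology X 1) =
      2 * Module.finrank ℂ ↥((hodge exists_isReal_hodgeModel_holds hX 1).piece 0 1) := by
  rw [BettiUniverse.finrank_bettiCohomology_eq_sum_hodgeNumber_hodge exists_isReal_hodgeModel_holds hX 1]
  simp only [Finset.sum_range_succ, Finset.sum_range_zero, zero_add, Nat.sub_zero, Nat.sub_self, Nat.cast_zero, Nat.cast_one]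
  rw [BettiUniverse.hodgeNumber_hodge_symm exists_isReal_hodgeModel_holds hX 1 1 0]
  simp only [HodgeStructure.hodgeNumber]
  ring

/-- **`b₁(X) = 0 ↔ q(X) = 0`** for a smooth projective complex variety. [cite: VoisinHodgeI2002, §6.1.3 Cor. 6.12 and Cor. 6.13] -/
theorem finrank_bettiCohomology_one_eq_zero_iff_irregularity_eq_zero {n : ℕ} {X : SchemeOver ℂ} (hX : IsSmoothProjective n X) :
    Module.finrank ℚ (bettiCohomology X 1) = 0 ↔
      Module.finrank ℂ ↥((hodge exists_isReal_hodgeModel_holds hX 1).piece 0 1) = 0 := by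
  rw [finrank_bettiCohomology_one_eq_two_mul_irregularity hX]
  omega

/-- **S1 from the vanishing of the irregularity of every desingularisation of the general quaternionic quartic plane** — the printed
currency `q(S) = 0` (module docstring, statement (Q)); via (D) of `…RegularOfDesingularization` and `b₁ = 2q`.
[cite: VoisinHodgeI2002, §6.1.3 Cor. 6.12 and Cor. 6.13] [cite: Kollar2007, Thm. 3.27 (p. 126)] -/
theorem stub_regularVeryGeneralQ_of_desingularizations_irregularity_zero
    (HQ : ∀ ⦃e : ℕ⦄, Even e → 4 ≤ e → ∃ g : ParamRing e, g ≠ 0 ∧ ∀ a : CIdx e → ℂ, MvPolynomial.eval a g ≠ 0 →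
      MvPolynomial.eval a (genericityElem e) ≠ 0 → ∀ (X₀ : SchemeOver ℂ) (hX₀ : IsSmoothProjective 2 X₀),
        AlgebraicGeometry.Scheme.BirationalOver X₀.hom (fiberSch e (MvPolynomial.eval a)).hom →
          Module.finrank ℂ ↥((hodge exists_isReal_hodgeModel_holds hX₀ 1).piece 0 1) = 0) :
open Literature.AlgebraicGeometry.Motives Literature.AlgebraicGeometry.HodgeTheory Literature.AlgebraicGeometry.HodgeTheory.BettiUniverse CategoryTheory.Limits in ∀ ⦃e : ℕ⦄, Even e → 4 ≤ e → ∃ G : ℕ → MvPolynomial ({d : Fin 3 →₀ ℕ // d.degree = 1} ⊕ {d : Fin 3 →₀ ℕ // d.degree = e - 1}) ℂ, (∀ i, ∃ c ψ : MvPolynomial (Fin 3) ℂ, c.IsHomogeneous 1 ∧ ψ.IsHomogeneous (e - 1) ∧ MvPolynomial.rename (Equiv.swap (0 : Fin 3) 1) ψ = ψ ∧ MvPolynomial.eval (Sum.elim (fun d => c.coeff d.1) (fun d => ψ.coeff d.1)) (G i) ≠ 0) ∧ ∀ c ψ : MvPolynomial (Fin 3) ℂ, c.IsHomogeneous 1 →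 ψ.IsHomogeneous (e - 1) → MvPolynomial.rename (Equiv.swap (0 : Fin 3) 1) ψ = ψ → (∀ i, MvPolynomial.eval (Sum.elim (fun d => c.coeff d.1) (fun d => ψ.coeff d.1)) (G i) ≠ 0) → ∀ ⦃V X : SchemeOver ℂ⦄ (hX : IsSmoothProjective 2 X), IsHypersurfaceCutOutBy 3 (MvPolynomial.X (Fin.last 3) ^ 4 * MvPolynomial.X (Fin.castSucc 2) ^ (2 * e) - MvPolynomial.rename Fin.castSucc (c * MvPolynomial.rename (Equiv.swap (0 : Fin 3) 1) c ^ 3 * ((MvPolynomial.X 0 - MvPolynomial.X 1) * ψ) ^ 2)) V → AlgebraicGeometry.Scheme.BirationalOver X.hom V.hom → Module.finrank ℚ (bettiCohomology X 1) = 0 := by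
  refine Q8SymplecticPowersRegularOfDesingularization.stub_regularVeryGeneralQ_of_desingularizations_regular fun e he h4 => ?_
  obtain ⟨g, hg, hQ⟩ := HQ he h4
  exact ⟨g, hg, fun a hga hGa X₀ hX₀ hbir =>
    (finrank_bettiCohomology_one_eq_zero_iff_irregularity_eq_zero hX₀).2 (hQ a hga hGa X₀ hX₀ hbir)⟩

end Summit.HodgeConjecture.HodgeConjecture.Theorems.Q8SymplecticPowersRegularOfIrregularityZero

end
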